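import Summits.CriticalPhenomena.PercolationContinuityZ3.Theorems.SahiMasterFamilyMinors

/-!
# `E_n` along one coordinate: polynomial structure in `s = p_e` for `x_e`-form families (all orders)

Support file of the master-family programme (crux `NoHeavyLowerTail`, stmt-CriticalPhenomena-4575; cell `prim-masterthm`, seat P4,
unit `prim-masterthm-p4-g7`).  Seat document HOME/prim-masterthm-p4/EQI3-RIGIDITY-PROOF.md §2.  First of two files (the second,
`SahiMasterFamilySharedCoordinate`, applies this to families of increasing events).

Fix a coordinate `e` and vary `p_e = s` (`p[e ↦ s]`, as in `SahiMasterFamilyCommonPivotal`).  For a family of functions each of which is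
either `e`-FREE (`g(ω ∪ {e}) = g(ω)`) or of the form `x_e · g` with `g` `e`-free (`x_e` the indicator of "`e` open"), Sahi's functional
`E_n(μ_{p[e↦s]}; F)` is a POLYNOMIAL in `s` of degree at most the number of `x_e`-slots, and when every slot carries `x_e` its `s^n`-coefficient is
`(−1)^{n−1} ∏_j E'(g_j)` (`exists_poly_xform`; induction on `n` along the Lieb–Sahi recursion, using `x_e² = x_e`; `E'` = the `e`-free expectation
`offEx`); and for a head slot `e`-free with all other slots `x_e`-form the `s^{n+1}`-coefficient of `E_{n+2}` is
`(−1)^n · [ Σ_i E'(g_i h) ∏_{j≠i} E'(g_j) − E'(h) ∏_j E'(g_j) ]` (`exists_poly_head_free`).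
HONEST FRAMING: bookkeeping toward criteria for NON-vanishing of `E_k` ((EQI-k) programme); nothing here bears on Sahi positivity `C_k`,
Kahn's Conj. 5 or the master theorem, which remain OPEN.  [this work]
-/

noncomputable section

open scoped Classical
open Polynomial

namespace Summit.CriticalPhenomena.PercolationContinuityZ3.Theorems

open Finset Function
open Literature.Combinatorics.Sahi2008
open Literature.Probability.Percolation.DecisionTree (ind ind_of_mem ind_of_not_mem ind_nonneg)

namespace SharedCoordinate

variable {ι : Type*} [Fintype ι]

/-! ### `e`-free functions and the indicator `x_e` -/

/-- The indicator of "`e` is open". [this work] -/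
def xInd (e : ι) : Set ι → ℝ := fun ω => if e ∈ ω then 1 else 0

/-- `g` is `e`-FREE: it ignores the coordinate `e`. [this work] -/
def Ignores (e : ι) (g : Set ι → ℝ) : Prop := ∀ ω, g (insert e ω) = g ω

omit [Fintype ι] in
/-- An `e`-free function also ignores the removal of `e`. [this work] -/
theorem Ignores.sdiff {e : ι} {g : Set ι → ℝ} (hg : Ignores e g) (ω : Set ι) : g (ω \ {e}) = g ω := by
  rw [← hg (ω \ {e}), Set.insert_sdiff_singleton]
  by_cases h : e ∈ ω
  · rw [Set.insert_eq_of_mem h]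
  · rw [← hg ω]

omit [Fintype ι] in
/-- Products of `e`-free functions are `e`-free. [this work] -/
theorem Ignores.mul {e : ι} {g h : Set ι → ℝ} (hg : Ignores e g) (hh : Ignores e h) : Ignores e (g * h) := fun ω => by
  rw [Pi.mul_apply, Pi.mul_apply, hg ω, hh ω]

omit [Fintype ι] in
/-- `x_e² = x_e`, so `(x_e g)(x_e h) = x_e (g h)`. [this work] -/
theorem xInd_mul_mul_xInd_mul (e : ι) (g h : Set ι → ℝ) : (xInd e * g) * (xInd e * h) = xInd e * (g * h) := by
  funext ω; simp only [Pi.mul_apply, xInd]; split_ifs <;> ring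

omit [Fintype ι] in
/-- `(x_e g) h = x_e (g h)`. [this work] -/
theorem xInd_mul_mul (e : ι) (g h : Set ι → ℝ) : (xInd e * g) * h = xInd e * (g * h) := by
  funext ω; simp only [Pi.mul_apply]; ring

omit [Fintype ι] in
/-- `g (x_e h) = x_e (g h)`. [this work] -/
theorem mul_xInd_mul (e : ι) (g h : Set ι → ℝ) : g * (xInd e * h) = xInd e * (g * h) := by
  funext ω; simp only [Pi.mul_apply]; ring

/-- The `e`-free expectation `E'(g) := Σ_{ω ∌ e} R_e(ω) g(ω)` (= `secEx p e g false`). [this work] -/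
def offEx (p : ι → unitInterval) (e : ι) (g : Set ι → ℝ) : ℝ := secEx p e g false

/-- For `e`-free `g`: `E_{p[e↦s]}(g) = E'(g)` for every `s`. [this work] -/
theorem ex_update_of_ignores (p : ι → unitInterval) (e : ι) (s : unitInterval) {g : Set ι → ℝ} (hg : Ignores e g) :
    ex (bernoulliWeight (update p e s)) g = offEx p e g := by
  rw [ex_update_eq]
  have h : secEx p e g true = secEx p e g false := by
    simp only [secEx]
    exact sum_congr rfl fun ω _ => by simp [hg ω]
  rw [h, offEx]; ring

/-- In particular `E_p(g) = E'(g)` for `e`-free `g`. [this work] -/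
theorem ex_eq_offEx (p : ι → unitInterval) (e : ι) {g : Set ι → ℝ} (hg : Ignores e g) : ex (bernoulliWeight p) g = offEx p e g := by
  have := ex_update_of_ignores p e (p e) hg
  rwa [update_eq_self] at this

/-- For `e`-free `g`: `E_{p[e↦s]}(x_e g) = s · E'(g)`. [this work] -/
theorem ex_update_xInd_mul (p : ι → unitInterval) (e : ι) (s : unitInterval) {g : Set ι → ℝ} (hg : Ignores e g) :
    ex (bernoulliWeight (update p e s)) (xInd e * g) = (s : ℝ) * offEx p e g := by
  rw [ex_update_eq]
  have h1 : secEx p e (xInd e * g) true = secEx p e g false := by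
    simp only [secEx]
    refine sum_congr rfl fun ω _ => ?_
    simp [xInd, hg ω]
  have h0 : secEx p e (xInd e * g) false = 0 := by
    simp only [secEx]
    refine sum_eq_zero fun ω hω => ?_
    have : e ∉ ω := (mem_filter.1 hω).2
    simp [xInd, this]
  rw [h1, h0, offEx]; ring

/-! ### Families of `x_e`-form and the polynomial structure of `E_n` in `s = p_e` -/

/-- The family with slot `j` equal to `x_e · G_j` (`κ j = true`) or `G_j` (`κ j = false`). [this work] -/
def xform (e : ι) {n : ℕ} (κ : Fin n → Bool) (G : Fin n → Set ι → ℝ) : Fin n → Set ι → ℝ :=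
  fun j => if κ j then xInd e * G j else G j

/-- Number of `true` entries drops the head: `#κ = [κ 0] + #(tail κ)`. [this work] -/
theorem card_filter_succ {n : ℕ} (κ : Fin (n + 1) → Bool) :
    (univ.filter fun j => κ j = true).card = (if κ 0 = true then 1 else 0) + (univ.filter fun j : Fin n => κ j.succ = true).card := by
  rw [card_filter, card_filter, Fin.sum_univ_succ]

/-- Updating one entry changes the number of `true`s by at most one. [this work] -/
theorem card_filter_update_le {n : ℕ} (κ : Fin n → Bool) (i : Fin n) (b : Bool) :
    (univ.filter fun j => update κ i b j = true).card ≤ (univ.filter fun j => κ j = true).card + 1 := by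
  calc (univ.filter fun j => update κ i b j = true).card
      ≤ (insert i (univ.filter fun j => κ j = true)).card := card_le_card fun j hj => by
        rw [mem_insert]
        by_cases hji : j = i
        · exact Or.inl hji
        · right
          have := (mem_filter.1 hj).2
          rw [update_of_ne hji] at this
          exact mem_filter.2 ⟨mem_univ _, this⟩
    _ ≤ _ := card_insert_le _ _

variable (p : ι → unitInterval) (e : ι)

/-- **`E_n(μ_{p[e↦s]}; F)` for an `x_e`-form family is a polynomial in `s` of degree `≤` the number of `x_e`-slots; when every slot carries `x_e`,
the coefficient of `s^n` is `(−1)^{n−1} ∏_j E'(G_j)`.** [this work] -/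
theorem exists_poly_xform : ∀ (n : ℕ) (κ : Fin n → Bool) (G : Fin n → Set ι → ℝ), (∀ j, Ignores e (G j)) →
    ∃ Q : ℝ[X], Q.natDegree ≤ (univ.filter fun j => κ j = true).card ∧
      (∀ s : unitInterval, sahiE (bernoulliWeight (update p e s)) n (xform e κ G) = Q.eval (s : ℝ)) ∧
      ((∀ j, κ j = true) → 1 ≤ n → Q.coeff n = (-1) ^ (n - 1) * ∏ j, offEx p e (G j))
  | 0, κ, G, _ => ⟨0, by simp, fun s => by rw [sahiE_zero, eval_zero], fun _ h => absurd h (by omega)⟩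
  | 1, κ, G, hG => by
    by_cases h0 : κ 0 = true
    · refine ⟨C (offEx p e (G 0)) * X, ?_, fun s => ?_, fun _ _ => ?_⟩
      · refine (natDegree_C_mul_le _ _).trans (natDegree_X_le.trans ?_)
        exact one_le_card.2 ⟨0, mem_filter.2 ⟨mem_univ _, h0⟩⟩
      · rw [sahiE_one_apply, xform, if_pos h0, ex_update_xInd_mul p e s (hG 0), eval_mul, eval_C, eval_X, mul_comm]
      · rw [coeff_C_mul, coeff_X_one, mul_one]
        simp
    · refine ⟨C (offEx p e (G 0)), (natDegree_C _).le.trans (Nat.zero_le _), fun s => ?_, fun hall _ => absurd (hall 0) h0⟩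
      rw [sahiE_one_apply, xform, if_neg h0, ex_update_of_ignores p e s (hG 0), eval_C]
  | n + 2, κ, G, hG => by
    -- the pieces of the recursion at slot 0
    set κt : Fin (n + 1) → Bool := fun j => κ j.succ with hκt
    set Gt : Fin (n + 1) → Set ι → ℝ := fun j => G j.succ with hGt
    have hGt' : ∀ j, Ignores e (Gt j) := fun j => hG j.succ
    have htail : Fin.tail (xform e κ G) = xform e κt Gt := by
      funext j; rfl
    -- the modified families
    set κ' : Fin (n + 1) → Fin (n + 1) → Bool := fun i => update κt i (κt i || κ 0) with hκ'
    set G' : Fin (n + 1) → Fin (n + 1) → Set ι → ℝ := fun i => update Gt i (Gt i * G 0) with hG'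
    have hG'' : ∀ i j, Ignores e (G' i j) := fun i j => by
      by_cases hji : j = i
      · subst hji; simp only [hG', update_self]; exact (hGt' j).mul (hG 0)
      · simp only [hG', update_of_ne hji]; exact hGt' j
    have hupd : ∀ i, update (Fin.tail (xform e κ G)) i (Fin.tail (xform e κ G) i * xform e κ G 0) = xform e (κ' i) (G' i) := by
      intro i
      rw [htail]
      funext j
      by_cases hji : j = i
      · subst hji
        simp only [update_self, xform, hκ', hG']
        by_cases h1 : κt j = true
        · by_cases h2 : κ 0 = true
          · rw [if_pos h1, if_pos h2, if_pos (by rw [h1, Bool.true_or]), xInd_mul_mul_xInd_mul]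
          · rw [if_pos h1, if_neg h2, if_pos (by rw [h1, Bool.true_or]), xInd_mul_mul]
        · by_cases h2 : κ 0 = true
          · rw [if_neg h1, if_pos h2, if_pos (by rw [h2, Bool.or_true]), mul_xInd_mul]
          · rw [if_neg h1, if_neg h2, if_neg (by rw [Bool.or_eq_true]; exact fun h => h.elim h1 h2)]
      · simp only [update_of_ne hji, xform, hκ', hG']
    -- induction hypotheses
    obtain ⟨Qt, hQt_deg, hQt_ev, hQt_top⟩ := exists_poly_xform (n + 1) κt Gt hGt'
    have IH' : ∀ i, ∃ Q : ℝ[X], Q.natDegree ≤ (univ.filter fun j => κ' i j = true).card ∧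
        (∀ s : unitInterval, sahiE (bernoulliWeight (update p e s)) (n + 1) (xform e (κ' i) (G' i)) = Q.eval (s : ℝ)) :=
      fun i => by
        obtain ⟨Q, h1, h2, -⟩ := exists_poly_xform (n + 1) (κ' i) (G' i) (hG'' i)
        exact ⟨Q, h1, h2⟩
    choose Qi hQi_deg hQi_ev using IH'
    -- the slot-0 expectation as a polynomial
    set c0 := offEx p e (G 0) with hc0
    set P0 : ℝ[X] := if κ 0 = true then C c0 * X else C c0 with hP0
    have hP0_ev : ∀ s : unitInterval, ex (bernoulliWeight (update p e s)) (xform e κ G 0) = P0.eval (s : ℝ) := by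
      intro s
      by_cases h0 : κ 0 = true
      · rw [hP0, if_pos h0, xform, if_pos h0, ex_update_xInd_mul p e s (hG 0), eval_mul, eval_C, eval_X, mul_comm]
      · rw [hP0, if_neg h0, xform, if_neg h0, ex_update_of_ignores p e s (hG 0), eval_C]
    have hP0_deg : P0.natDegree ≤ if κ 0 = true then 1 else 0 := by
      by_cases h0 : κ 0 = true
      · rw [hP0, if_pos h0, if_pos h0]; exact (natDegree_C_mul_le _ _).trans natDegree_X_le
      · rw [hP0, if_neg h0, if_neg h0]; exact (natDegree_C _).le
    -- counting `x_e`-slots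
    have hcount : (univ.filter fun j => κ j = true).card =
        (if κ 0 = true then 1 else 0) + (univ.filter fun j => κt j = true).card := card_filter_succ κ
    have hcount' : ∀ i, (univ.filter fun j => κ' i j = true).card ≤ (univ.filter fun j => κ j = true).card := by
      intro i
      rw [hcount]
      by_cases h0 : κ 0 = true
      · rw [if_pos h0]
        have := card_filter_update_le κt i (κt i || κ 0)
        simp only [hκ'] at this ⊢
        omega
      · have : κ' i = κt := by
          funext j; simp only [hκ']
          by_cases hji : j = i
          · subst hji; rw [update_self]; simp [h0]
          · rw [update_of_ne hji]
        rw [this, if_neg h0, zero_add]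
    -- the polynomial
    refine ⟨(∑ i, Qi i) - Qt * P0, ?_, fun s => ?_, fun hall _ => ?_⟩
    · refine (natDegree_sub_le _ _).trans (max_le ?_ ?_)
      · exact natDegree_sum_le_of_forall_le _ _ fun i _ => (hQi_deg i).trans (hcount' i)
      · refine natDegree_mul_le.trans ?_
        rw [hcount]
        calc Qt.natDegree + P0.natDegree ≤ (univ.filter fun j => κt j = true).card + (if κ 0 = true then 1 else 0) :=
              Nat.add_le_add hQt_deg hP0_deg
          _ = _ := add_comm _ _
    · rw [sahiE_succ_succ, eval_sub, eval_finsetSum, eval_mul, ← hQt_ev s, ← hP0_ev s, htail]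
      congr 1
      exact sum_congr rfl fun i _ => by rw [← htail, hupd i, hQi_ev i s]
    · -- top coefficient when every slot carries `x_e`
      have h0 : κ 0 = true := hall 0
      have hallt : ∀ j, κt j = true := fun j => hall j.succ
      have hall' : ∀ i j, κ' i j = true := fun i j => by
        simp only [hκ']
        by_cases hji : j = i
        · subst hji; rw [update_self]; simp [hallt j]
        · rw [update_of_ne hji]; exact hallt j
      have hQi0 : ∀ i, (Qi i).coeff (n + 2) = 0 := fun i => by
        refine coeff_eq_zero_of_natDegree_lt ((hQi_deg i).trans_lt ?_)
        calc (univ.filter fun j => κ' i j = true).card ≤ (univ : Finset (Fin (n + 1))).card := card_filter_le _ _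
          _ = n + 1 := by rw [card_univ, Fintype.card_fin]
          _ < n + 2 := by omega
      have hQt' : Qt.coeff (n + 1) = (-1) ^ n * ∏ j, offEx p e (Gt j) := by
        have := hQt_top hallt (by omega); simpa using this
      have hprod : ∏ j : Fin (n + 2), offEx p e (G j) = offEx p e (G 0) * ∏ j : Fin (n + 1), offEx p e (Gt j) :=
        Fin.prod_univ_succ _
      rw [coeff_sub, finsetSum_coeff, sum_eq_zero (fun i _ => hQi0 i), zero_sub, hP0, if_pos h0, ← mul_assoc, coeff_mul_X,
        coeff_mul_C, hQt', hprod, hc0, show n + 2 - 1 = n + 1 by omega, pow_succ]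
      ring

/-! ### Head slot `e`-free, all other slots `x_e`-form: the top coefficient -/

/-- **`E_{n+2}(μ_{p[e↦s]}; h, x_e G_0, …, x_e G_n)`** for `e`-free `h, G_j`: a polynomial of degree `≤ n + 1` in `s` with `s^{n+1}`-coefficient
`(−1)^n · [ Σ_i E'(G_i h) ∏_{j≠i} E'(G_j) − E'(h) ∏_j E'(G_j) ]`. [this work] -/
theorem exists_poly_head_free (n : ℕ) {h : Set ι → ℝ} (hh : Ignores e h) (G : Fin (n + 1) → Set ι → ℝ) (hG : ∀ j, Ignores e (G j)) :
    ∃ Q : ℝ[X], Q.natDegree ≤ n + 1 ∧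
      (∀ s : unitInterval, sahiE (bernoulliWeight (update p e s)) (n + 2) (Matrix.vecCons h (fun j => xInd e * G j)) = Q.eval (s : ℝ)) ∧
      Q.coeff (n + 1) = (-1) ^ n * ((∑ i, offEx p e (G i * h) * ∏ j ∈ univ.erase i, offEx p e (G j)) -
        offEx p e h * ∏ j, offEx p e (G j)) := by
  -- all-`x_e` families and Part 1
  have hx : ∀ (G' : Fin (n + 1) → Set ι → ℝ), (fun j => xInd e * G' j) = xform e (fun _ => true) G' := fun G' => by
    funext j; simp [xform]
  have hcard : (univ.filter fun j : Fin (n + 1) => (fun _ : Fin (n + 1) => true) j = true).card = n + 1 := by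
    rw [filter_true_of_mem fun j _ => rfl, card_univ, Fintype.card_fin]
  -- the tail
  obtain ⟨Qt, hQt_deg, hQt_ev, hQt_top⟩ := exists_poly_xform p e (n + 1) (fun _ => true) G hG
  rw [hcard] at hQt_deg
  have hQt' : Qt.coeff (n + 1) = (-1) ^ n * ∏ j, offEx p e (G j) := by
    have := hQt_top (fun _ => rfl) (by omega); simpa using this
  -- the modified families
  have IH' : ∀ i : Fin (n + 1), ∃ Q : ℝ[X], Q.natDegree ≤ n + 1 ∧
      (∀ s : unitInterval, sahiE (bernoulliWeight (update p e s)) (n + 1)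
        (update (fun j => xInd e * G j) i ((fun j => xInd e * G j) i * h)) = Q.eval (s : ℝ)) ∧
      Q.coeff (n + 1) = (-1) ^ n * (offEx p e (G i * h) * ∏ j ∈ univ.erase i, offEx p e (G j)) := by
    intro i
    have hGi : ∀ j, Ignores e (update G i (G i * h) j) := fun j => by
      by_cases hji : j = i
      · subst hji; rw [update_self]; exact (hG j).mul hh
      · rw [update_of_ne hji]; exact hG j
    obtain ⟨Q, h1, h2, h3⟩ := exists_poly_xform p e (n + 1) (fun _ => true) (update G i (G i * h)) hGi
    rw [hcard] at h1
    have hfam : update (fun j => xInd e * G j) i ((fun j => xInd e * G j) i * h) = xform e (fun _ => true) (update G i (G i * h)) := by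
      funext j
      by_cases hji : j = i
      · subst hji; simp only [update_self, xform, if_true, xInd_mul_mul]
      · simp only [update_of_ne hji, xform, if_true]
    refine ⟨Q, h1, fun s => by rw [hfam, h2 s], ?_⟩
    rw [h3 (fun _ => rfl) (by omega), ← mul_prod_erase univ (fun j => offEx p e (update G i (G i * h) j)) (mem_univ i), update_self]
    simp only [Nat.add_sub_cancel]
    congr 2
    exact prod_congr rfl fun j hj => by rw [update_of_ne (ne_of_mem_erase hj)]
  choose Qi hQi_deg hQi_ev hQi_top using IH'
  refine ⟨(∑ i, Qi i) - Qt * C (offEx p e h), ?_, fun s => ?_, ?_⟩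
  · refine (natDegree_sub_le _ _).trans (max_le (natDegree_sum_le_of_forall_le _ _ fun i _ => hQi_deg i) ?_)
    exact natDegree_mul_le.trans (by rw [natDegree_C, add_zero]; exact hQt_deg)
  · rw [sahiE_cons, eval_sub, eval_finsetSum, eval_mul, eval_C, hx G, ← hQt_ev s, ← hx G, ex_update_of_ignores p e s hh]
    congr 1
    exact sum_congr rfl fun i _ => hQi_ev i s
  · rw [coeff_sub, finsetSum_coeff, coeff_mul_C, hQt', sum_congr rfl fun i _ => hQi_top i, ← mul_sum]
    ring

end SharedCoordinate

end Summit.CriticalPhenomena.PercolationContinuityZ3.Theorems
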